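import Summits.HubbardSuperconductivity.HubbardSuperconductivity.Theorems.AnisotropyChordTransferFibre3FinXBCover

/-!
# Route `AnisotropyChord` / H0 rotor rung: FIN exact-block row-`N₁` certificate at `L = 14` — cell facts, part `e`

Kernel facts `xbCellAny 14 (49/50) la lb c = true` (`decide +kernel`, zero data) for 6 λ-cells of the per-`L` cover
(`…FinXBCover.xbCheck`; cell design: p3 g5 scratch `xb_design.py`, float mirror `xb_mirror.py`); assembled in `…FinXBFourteen`.
Prover seat `hubbard-h0-rotor-p3` g5; helper for piece A = stmt-HubbardSuperconductivity-23918 of rung 19089 (`--supports`, helper class).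
WHAT THIS IS NOT: nothing here proves superconductivity in the Hubbard model (rotor TARGET as worded stays FALSE, g15 verdict); kernel facts for the FIN certificate of ONE hypothesis (row `N₁`) of ONE conditional reduction.  Tree imports only; no sorry, no new axioms.
-/

namespace Summit.HubbardSuperconductivity.HubbardSuperconductivity.Theorems.AnisotropyChord.Transfer.Fibre3

namespace FinXB

set_option maxHeartbeats 4000000 in
/-- kernel fact: cell 38 at `L = 14` (certified, c = (9/20 : ℚ)). [folklore] -/
theorem xb14_38 : xbCellAny 14 (49/50 : ℚ) 1243283358847272 1317880360378109 (9/20 : ℚ) = true := by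
  decide +kernel

set_option maxHeartbeats 4000000 in
/-- kernel fact: cell 39 at `L = 14` (certified, c = (9/20 : ℚ)). [folklore] -/
theorem xb14_39 : xbCellAny 14 (49/50 : ℚ) 1317880360378109 1396953182000796 (9/20 : ℚ) = true := by
  decide +kernel

set_option maxHeartbeats 4000000 in
/-- kernel fact: cell 40 at `L = 14` (certified, c = (9/20 : ℚ)). [folklore] -/
theorem xb14_40 : xbCellAny 14 (49/50 : ℚ) 1396953182000796 1480770372920844 (9/20 : ℚ) = true := by
  decide +kernel

set_option maxHeartbeats 4000000 in
/-- kernel fact: cell 41 at `L = 14` (certified, c = (9/20 : ℚ)). [folklore] -/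
theorem xb14_41 : xbCellAny 14 (49/50 : ℚ) 1480770372920844 1569616595296095 (9/20 : ℚ) = true := by
  decide +kernel

set_option maxHeartbeats 4000000 in
/-- kernel fact: cell 42 at `L = 14` (certified, c = (9/20 : ℚ)). [folklore] -/
theorem xb14_42 : xbCellAny 14 (49/50 : ℚ) 1569616595296095 1663793591013861 (9/20 : ℚ) = true := by
  decide +kernel

set_option maxHeartbeats 4000000 in
/-- kernel fact: cell 43 at `L = 14` (certified, c = (9/20 : ℚ)). [folklore] -/
theorem xb14_43 : xbCellAny 14 (49/50 : ℚ) 1663793591013861 1763621206474693 (9/20 : ℚ) = true := by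
  decide +kernel

end FinXB

end Summit.HubbardSuperconductivity.HubbardSuperconductivity.Theorems.AnisotropyChord.Transfer.Fibre3
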